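import Summits.KontsevichZagierPeriods.Zeta5Search.Certificates.TwoTaleTelescopeKit

/-!
# ζ(2) two-tale line — kit supplement: UNIVARIATE certificate data with large coefficients (cell `pub-zeta5`, certifier `cert-2`)

HONEST FRAMING: systematic search; recurrence certificates; no irrationality claim unless certified.

The aef-direction FAMILY certificates of fam-tele's parametric (bmiss) proof (`certs/tele/bmiss_general/fam_aef_cert.json`) are
univariate in the family parameter `a` with integer coefficients of up to ~45 digits (side R), beyond the `2^64` offset of the
packed five-variable terms of `TwoTaleTelescopeKit`. Here: a sign–magnitude encoding `zdec (2|c| + [c<0])` of integers by naturals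
(fast-elaborating literals), Horner trees `upolyNE` in `v₀ = a` with semantics `upvalN`, and `polyTUE`/`polyTU` for
`x(a,t+s) = Σ_j x_j(a)(t+s)^j`. General tooling; no named facts.
-/

namespace Summit.KontsevichZagierPeriods.Zeta5Search.Certificates

namespace TwoTaleTelescope

open PolyReflect
open Lean.Grind.CommRing (Expr)

variable {R : Type*} [CommRing R]

/-- Sign–magnitude decoding: `zdec (2m) = m`, `zdec (2m+1) = −m`. -/
def zdec (n : ℕ) : ℤ := if n % 2 = 0 then ((n / 2 : ℕ) : ℤ) else -((n / 2 : ℕ) : ℤ)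

/-- Horner value `Σ_i zdec(cs[i]) · a^i` of an encoded coefficient list (low degree first). -/
def upvalN : List ℕ → R → R
  | [], _ => 0
  | c :: cs, a => (zdec c : R) + a * upvalN cs a

/-- The Horner tree in `v₀` of an encoded coefficient list. -/
def upolyNE : List ℕ → Expr
  | [] => .num 0
  | c :: cs => .add (.num (zdec c)) (.mul (.var 0) (upolyNE cs))

/-- Semantics of `upolyNE` (any values in slots 1–5). -/
theorem peval_upolyNE (a b e f g t : R) : ∀ cs : List ℕ, peval (upolyNE cs) [a, b, e, f, g, t] = upvalN cs a
  | [] => by rw [upolyNE, peval_num, upvalN]; simp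
  | c :: cs => by
      have d0 : pvar [a, b, e, f, g, t] 0 = a := rfl
      rw [upolyNE, peval_add, peval_num, peval_mul, peval_var, d0, peval_upolyNE a b e f g t cs, upvalN]

/-- `polyTU xs s a t = Σ_j upvalN xs[j] a · (t+s)^j`. -/
def polyTU (xs : List (List ℕ)) (s : ℤ) (a t : R) : R :=
  ((List.range xs.length).map fun j => upvalN (xs.getD j []) a * (t + (s : R)) ^ j).sum

/-- `polyTU` as a reflected expression (`v₀ = a`, `v₅ = t`). -/
def polyTUE (xs : List (List ℕ)) (s : ℤ) : Expr :=
  (List.range xs.length).foldr (fun j acc => .add (.mul (upolyNE (xs.getD j [])) (.pow (.add (.var 5) (.num s)) j)) acc) (.num 0)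

/-- Semantics of `polyTUE` (auxiliary, over an index list). -/
theorem peval_polyTUE_aux (xs : List (List ℕ)) (s : ℤ) (a b e f g t : R) :
    ∀ js : List ℕ, peval (js.foldr (fun j acc => Expr.add (.mul (upolyNE (xs.getD j [])) (.pow (.add (.var 5) (.num s)) j)) acc)
      (.num 0)) [a, b, e, f, g, t] = (js.map fun j => upvalN (xs.getD j []) a * (t + (s : R)) ^ j).sum
  | [] => by simp [peval_num]
  | j :: js => by
      have d5 : pvar [a, b, e, f, g, t] 5 = t := rfl
      rw [List.foldr_cons, peval_add, peval_mul, peval_upolyNE, peval_pow, peval_add, peval_var, d5, peval_num,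
        peval_polyTUE_aux xs s a b e f g t js, List.map_cons, List.sum_cons]

/-- Semantics of `polyTUE`. -/
theorem peval_polyTUE (xs : List (List ℕ)) (s : ℤ) (a b e f g t : R) :
    peval (polyTUE xs s) [a, b, e, f, g, t] = polyTU xs s a t := by
  rw [polyTUE, peval_polyTUE_aux, polyTU]

end TwoTaleTelescope

end Summit.KontsevichZagierPeriods.Zeta5Search.Certificates
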